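import Mathlib
import Summits.AnomalousDissipation.AnomalousDissipation.Theses.PointSink
import Literature.Analysis.FluidPDE.VectorCalculus
import Literature.Analysis.FluidPDE.HomogeneousEuler
import Summits.AnomalousDissipation.AnomalousDissipation.Theorems.PointFluxCone.Negative.ClassicalFluxRigidityNoC1Witness

/-!
# Disproof of `PointFluxCone` (stmt-AnomalousDissipation-19033) — findings of the cdisprove seat

Crux (route `PointSink`, rank 2): `∃ λ > 1, V, P` on `ℝ³ ∖ {0}`, discretely self-similar of degrees
`(−2/3, −4/3)` under `x ↦ λx`, `|V|², P ∈ L¹_loc` off `0`, weak stationary Euler off the origin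
(tests `IsTestFunctionOn ⟨{x ≠ 0}, _⟩` = `C^∞`, compact support, `tsupport ⊆ {x ≠ 0}`), weakly
divergence free, with the radial energy–flux density `(½|V|² + P) ⟪V, x⟫/|x|²` integrable on the
fundamental shell `1 < |x| < λ` and of NON-ZERO integral.

## Findings (cycle 1) — LANDED negative lemmas (all sorry-free, axioms standard)

Tree files `Summits/AnomalousDissipation/AnomalousDissipation/Theorems/PointFluxCone/Negative/`:
* `ClassicalFluxRigidityRadialTests.lean` (p160021) — `|c·arctan(s/c)| ≤ |s|`, limits `c → ∞ / 0⁺`;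
  radial `C¹_c` tests `ρ(|x|²)` with `ρ' = (ζ − ζ(·/L))/u` (`exists_radialTest`).
* `ClassicalFluxRigidityTransport.lean` (p160152) — IBP off the origin for `C¹` div-free fields
  (`integral_inner_gradient_eq_zero_off_zero`), Bernoulli `DB[V] = 0` (`fderiv_head_apply_self`),
  `div (h(B) V) = 0` (`divergence_head_smul_eq_zero`).
* `ClassicalFluxRigidityFunctionals.lean` (p160679) — level functionals
  `N_c(ζ) = ∫ c·arctan(B/c) ⟪V,x⟫|x|⁻² ζ(|x|²)`: transport invariance `ζ ↦ ζ(·/L)`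
  (`integral_transport_invariant`), DSS level shift `N_c(ζ(·/λ²)) = N_{λ^{4/3}c}(ζ)`
  (`integral_level_comp_div_eq`), limits, `integral_flux_weight_eq_zero`.
* `ClassicalFluxRigidity.lean` — `shellFlux_eq_zero_of_classical`,
  `not_exists_classical_pointFluxCone`, `shellFlux_eq_zero_of_isHomogeneousSteadyEuler`
  (flux part of Shvydkoy 2018 Lemma 6.1 PROVED for the tree's `IsHomogeneousSteadyEuler (2/3)`).
* `ClassicalFluxRigidityNoC1Witness.lean` — weak ⇒ classical for `C¹`-off-origin pairs
  (`divergence_eq_zero_of_weak`, `momentum_eq_zero_of_weak`, fundamental lemma + continuity),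
  `pointFluxCone_witness_not_contDiffOn`, `not_exists_pointFluxCone_contDiffOn`.

Below, the two NATURAL STRENGTHENINGS of the crux are stated as defs and REFUTED by those files.

## Readback and cheap attacks

* READBACK (rc 0): junk-free. `lam ^ (-(2/3 : ℝ))` is `Real.rpow` with `lam > 1`; the Bochner
  integrals in the Euler / divergence clauses are genuine (integrands `L¹` because tests vanish near
  `0` and outside a compact set, `|V|² ∈ L¹_loc`, `P ∈ L¹_loc` off `0`); the flux clause carries an
  explicit `IntegrableOn`; `V ↦ −V` preserves clauses (1)–(9) and flips the sign of (10). The weak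
  equations extend across the origin automatically (a distribution supported at `0` cannot be DSS of
  degree `−7/3` or `−5/3`), so no hidden extra constraint and no hidden loophole there.
* NOT cheaply refutable and NOT cheaply provable: the statement is the `0`-dimensional stationary
  Onsager problem (existence side open: homogeneous Euler flows are known only for degrees
  `∉ [−2, 0]`, Abe 2024; stationary convex integration gives `L^∞` flows with prescribed `|v|²` but no
  flux statement). A disproof would be a rigidity theorem for ALL `L²_loc × L¹_loc` DSS weak cones —
  far below every renormalisation / Onsager threshold; implausible. No skeleton / stubs are
  registered for the crux yet (`Targets`: none this cycle).
* WHY IT RESISTS (the mechanism, now kernel-checked in the classical class): for a steady Euler pair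
  the Bernoulli head `B = ½|V|² + P` is transported, `V·∇B = 0`, hence `div (h(B) V) = 0` for every
  `C¹` profile `h`; with the one-parameter family `h_c(s) = c·arctan(s/c)` the DSS change of variables
  maps the shell functional at level `c` to the one at level `λ^{4/3} c` (degree `−2/3` is exactly the
  one for which no power of `λ` survives), so the functional is log-periodic in `c`; it tends to the
  flux as `c → ∞` and to `0` as `c → 0`, so the flux log-mean vanishes. Consequently ANY witness of
  the crux must be a pair for which renormalised transport FAILS in the bulk of every shell: not `C¹`
  off the origin (landed), not `C¹` off thin conical sets / conical sheets / `C^{1/2+}` (same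
  mechanism; ideators' notes `BARRIER-renormalised-bernoulli-rigidity.md`, `flux-rigidity-note.md`) —
  i.e. convex-integration roughness with a SIGNED Duchon–Robert defect (net defect per fundamental
  shell is zero by the same scaling). NOTE TO PLANNER (not a defect): the crux as typed lets the
  non-zero log-mean come from bulk roughness rather than from a point flux; `ConeDesingularisation`
  uses the cone as a far-field datum, where an "honest" (defect-free off `0`) flux would be needed —
  and every renormalisable honest cone is fluxless.

## Contents

* `PointFluxConeClassical` / `not_pointFluxConeClassical` — strengthening 1 (classical `C¹` DSS
  steady Euler off the origin with non-zero shell flux): REFUTED (`not_exists_classical_pointFluxCone`).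
* `PointFluxConeC1` / `not_pointFluxConeC1` — strengthening 2 (the crux VERBATIM ∧ "`V`, `P` are
  `C¹` off the origin"): REFUTED (`not_exists_pointFluxCone_contDiffOn`).
-/

set_option linter.dupNamespace false

noncomputable section

open MeasureTheory Metric Filter Topology Set
open Literature.Analysis.FluidPDE

namespace Summit.AnomalousDissipation.AnomalousDissipation.Cruxes.PointFluxCone.Disproof

local notation "E³" => EuclideanSpace ℝ (Fin 3)

/-- The shell flux log-mean of the crux: `∫_{1<|x|<λ} (½|V|² + P) ⟪V, x⟫ / |x|² dx`
(`= log λ ×` the sphere flux when the latter is scale independent). [folklore] -/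
def shellFlux (lam : ℝ) (V : E³ → E³) (P : E³ → ℝ) : ℝ :=
  ∫ x in {x : E³ | 1 < ‖x‖ ∧ ‖x‖ < lam}, (‖V x‖ ^ 2 / 2 + P x) * (inner ℝ (V x) x / ‖x‖ ^ 2)

/-- NATURAL STRENGTHENING 1 — `PointFluxCone` in the classical class: a DSS pair of degrees
`(−2/3, −4/3)` which is `C¹` on `ℝ³ ∖ {0}` and solves `(V·∇)V + ∇P = 0`, `div V = 0` pointwise off
the origin, with non-zero shell flux. (Measurability, local integrability and the weak clauses of the
crux are then automatic, so this is literally "`PointFluxCone` ∧ `C¹`".) [folklore] -/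
def PointFluxConeClassical : Prop :=
  ∃ (lam : ℝ) (V : E³ → E³) (P : E³ → ℝ), 1 < lam ∧
    ContDiffOn ℝ 1 V {x : E³ | x ≠ 0} ∧ ContDiffOn ℝ 1 P {x : E³ | x ≠ 0} ∧
    (∀ x : E³, x ≠ 0 → V (lam • x) = lam ^ (-(2 / 3 : ℝ)) • V x) ∧
    (∀ x : E³, x ≠ 0 → P (lam • x) = lam ^ (-(4 / 3 : ℝ)) * P x) ∧
    (∀ x : E³, x ≠ 0 → VectorCalculus.divergence V x = 0) ∧
    (∀ x : E³, x ≠ 0 → convect V V x + gradient P x = 0) ∧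
    shellFlux lam V P ≠ 0

/-- **Refutation of strengthening 1 (classical DSS flux rigidity)**, from the landed
`Negative.not_exists_classical_pointFluxCone` (arctan-head renormalisation + DSS level shift
`c ↦ λ^{4/3} c` + the two limits `c → 0`, `c → ∞`; radial tests `ρ(|x|²)`, no sphere integrals).
[folklore] -/
theorem not_pointFluxConeClassical : ¬ PointFluxConeClassical :=
  Summit.AnomalousDissipation.AnomalousDissipation.Theorems.PointFluxCone.Negative.not_exists_classical_pointFluxCone

/-- NATURAL STRENGTHENING 2 — the crux VERBATIM with one extra clause: the witness is `C¹` off the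
origin. [folklore] -/
def PointFluxConeC1 : Prop :=
  ∃ (lam : ℝ) (V : E³ → E³) (P : E³ → ℝ), 1 < lam ∧
    MeasureTheory.AEStronglyMeasurable V MeasureTheory.volume ∧
    (∀ x : E³, x ≠ 0 → V (lam • x) = lam ^ (-(2 / 3 : ℝ)) • V x) ∧
    (∀ x : E³, x ≠ 0 → P (lam • x) = lam ^ (-(4 / 3 : ℝ)) * P x) ∧
    MeasureTheory.LocallyIntegrableOn (fun x => ‖V x‖ ^ 2) {x : E³ | x ≠ 0} MeasureTheory.volume ∧
    MeasureTheory.LocallyIntegrableOn P {x : E³ | x ≠ 0} MeasureTheory.volume ∧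
    (∀ φ : E³ → E³, Literature.Analysis.FunctionSpaces.IsTestFunctionOn ⟨{x : E³ | x ≠ 0}, isOpen_ne⟩ φ →
      ∫ x, (inner ℝ (V x) (fderiv ℝ φ x (V x)) + P x * VectorCalculus.divergence φ x) = 0) ∧
    (∀ θ : E³ → ℝ, Literature.Analysis.FunctionSpaces.IsTestFunctionOn ⟨{x : E³ | x ≠ 0}, isOpen_ne⟩ θ →
      ∫ x, inner ℝ (V x) (gradient θ x) = 0) ∧
    MeasureTheory.IntegrableOn (fun x => (‖V x‖ ^ 2 / 2 + P x) * (inner ℝ (V x) x / ‖x‖ ^ 2))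
      {x : E³ | 1 < ‖x‖ ∧ ‖x‖ < lam} MeasureTheory.volume ∧
    (∫ x in {x : E³ | 1 < ‖x‖ ∧ ‖x‖ < lam}, (‖V x‖ ^ 2 / 2 + P x) * (inner ℝ (V x) x / ‖x‖ ^ 2)) ≠ 0 ∧
    ContDiffOn ℝ 1 V {x : E³ | x ≠ 0} ∧ ContDiffOn ℝ 1 P {x : E³ | x ≠ 0}

/-- **Refutation of strengthening 2**: no witness of `PointFluxCone` is `C¹` off the origin, from
the landed `Negative.not_exists_pointFluxCone_contDiffOn` (weak ⇒ classical by integration by parts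
behind a radial cut-off + the fundamental lemma of the calculus of variations + continuity, then
strengthening 1). [folklore] -/
theorem not_pointFluxConeC1 : ¬ PointFluxConeC1 :=
  Summit.AnomalousDissipation.AnomalousDissipation.Theorems.PointFluxCone.Negative.not_exists_pointFluxCone_contDiffOn

/-- The witness form, for planners/provers: any `(λ, V, P)` satisfying the clauses of the crux has
`V` or `P` not `C¹` on `ℝ³ ∖ {0}` (re-export of the landed theorem). [folklore] -/
theorem witness_not_contDiffOn {lam : ℝ} {V : E³ → E³} {P : E³ → ℝ} (hlam : 1 < lam)
    (hVs : ∀ x : E³, x ≠ 0 → V (lam • x) = lam ^ (-(2 / 3 : ℝ)) • V x)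
    (hPs : ∀ x : E³, x ≠ 0 → P (lam • x) = lam ^ (-(4 / 3 : ℝ)) * P x)
    (hmomw : ∀ φ : E³ → E³, Literature.Analysis.FunctionSpaces.IsTestFunctionOn ⟨{x : E³ | x ≠ 0}, isOpen_ne⟩ φ →
      ∫ x, (inner ℝ (V x) (fderiv ℝ φ x (V x)) + P x * VectorCalculus.divergence φ x) = 0)
    (hdivw : ∀ θ : E³ → ℝ, Literature.Analysis.FunctionSpaces.IsTestFunctionOn ⟨{x : E³ | x ≠ 0}, isOpen_ne⟩ θ →
      ∫ x, inner ℝ (V x) (gradient θ x) = 0)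
    (hne : shellFlux lam V P ≠ 0) :
    ¬ (ContDiffOn ℝ 1 V {x : E³ | x ≠ 0} ∧ ContDiffOn ℝ 1 P {x : E³ | x ≠ 0}) :=
  Summit.AnomalousDissipation.AnomalousDissipation.Theorems.PointFluxCone.Negative.pointFluxCone_witness_not_contDiffOn
    hlam hVs hPs hmomw hdivw hne

end Summit.AnomalousDissipation.AnomalousDissipation.Cruxes.PointFluxCone.Disproof

end
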